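import Summits.CriticalPhenomena.SAWScalingLimit.Theses.SAWLaplacianWalk
import Summits.CriticalPhenomena.SAWScalingLimit.Theorems.SAWRenewalTightnessEventualTightSplit
import HarnessLib

/-!
# Split glue for the `SAWLaplacianWalk` copy of the crux: `ConfinementPositivity → BulkShellTight → SAWLaplacianWalk.EventualTight`

Registered stub `EventualTightAlongMesh_of_subs` of the shared crux item stmt-CriticalPhenomena-1881 (filed by crux-strategist s1,
2026-08-17T05:45Z; Theorems/ is prover-only, so the strategist's kernel-checked file could not be landed by that seat).  The two
hypotheses are, verbatim, the bodies of the two children of the set-form split of the crux on route `SAWRenewalTightness`: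

* E = restriction positivity `ConfinementPositivity` (item stmt-CriticalPhenomena-17587);
* `BulkShellTight` (item stmt-CriticalPhenomena-17588): per-shell traversal tightness of every bulk shell `D(y; η, R)` with
  `B̄(y, 2R) ⊆ Ω`, eventually in the mesh.

Composition (no content of its own): the landed set-form glue `Theorems.EventualTight_of_subs : E → BulkShellTight →
SAWRenewalTightness.EventualTight` (`ShellCrossingBound_of_subs` + the Aizenman–Burchard criterion `TightOfShellCrossing_proof`)
followed by the Literature bridge `isTightAlongMesh_of_isTightMeasureSet_image` (a tight image of `(0, δ₀]` is tight along `𝓝[>] 0`;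
the SAW observable is measurable for the discrete σ-algebra).  With this file in the tree the route-level split of the along-the-mesh
crux on `route-CriticalPhenomena-SAWLaplacianWalk` into the existing items stmt-17587 / stmt-17588 can cite `--glue-by` this declaration.

References: Aizenman–Burchard, Duke Math. J. 99 (1999), Thms 1.1–1.2 and Lemma 3.1 (tightness from traversal-count bounds);
Duminil-Copin–Smirnov, Ann. of Math. 175 (2012), §4 (the critical SAW law of a discrete domain).
-/

noncomputable section

open MeasureTheory Filter Topology Set Metric
open scoped ENNReal NNReal unitInterval
open Literature.Probability.RandomPlanarGeometry Literature.Probability.LatticeModels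

namespace Summit.CriticalPhenomena.SAWScalingLimit.Theorems.SAWLaplacianWalkSplit

/-- **Split glue (registered stub `EventualTightAlongMesh_of_subs`)**: restriction positivity E (= item stmt-17587) and bulk-shell
traversal tightness (= item stmt-17588) imply the along-the-mesh crux `SAWLaplacianWalk.EventualTight`, by the landed set-form glue
`Theorems.EventualTight_of_subs` and the bridge `isTightAlongMesh_of_isTightMeasureSet_image`.
[cite: AizenmanBurchardDuke1999, Thms 1.1-1.2] -/
theorem EventualTightAlongMesh_of_subs : (∀ (D D' : Literature.Probability.RandomPlanarGeometry.DobrushinDomain) (a b : ℝ → Literature.Probability.LatticeModels.Site 2) (d : ℝ), 0 < d → D'.carrier ⊆ D.carrier → D'.pt 0 = D.pt 0 → D'.pt 1 = D.pt 1 → D.carrier ∩ (Metric.ball (D.pt 0) d ∪ Metric.ball (D.pt 1) d) ⊆ D'.carrier → Literature.Probability.RandomPlanarGeometry.SAW.IsEndpointApprox D' a b → ∃ c δ₀ : ℝ, 0 < c ∧ 0 < δ₀ ∧ ∀ δ ∈ Set.Ioc (0 : ℝ) δ₀, ENNReal.ofReal c ≤ Literature.Probability.RandomPlanarGeometry.SAW.law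 D.carrier δ (a δ) (b δ) {γ | ∃ γ' : Literature.Probability.RandomPlanarGeometry.SAW.DomainSAW D'.carrier δ (a δ) (b δ), γ'.walk.support = γ.walk.support}) → (∀ (D : Literature.Probability.RandomPlanarGeometry.DobrushinDomain) (a b : ℝ → Literature.Probability.LatticeModels.Site 2), Literature.Probability.RandomPlanarGeometry.SAW.IsEndpointApprox D a b → ∀ (y : ℂ) (η R : ℝ), 0 < η → η < R → Metric.closedBall y (2 * R) ⊆ D.carrier → ∀ ε : ℝ, 0 < ε → ∃ (j : ℕ) (δ₁ : ℝ), 0 < δ₁ ∧ ∀ δ ∈ Set.Ioc (0 : ℝ) δ₁, Literature.Probability.RandomPlanarGeometry.SAW.law D.carrier δ (a δ) (b δ) {γ | (⟨γ.walk.toCurve (Literature.Probability.LatticeModels.meshPoint δ)⟩ : Literature.Probability.RandomPlanarGeometry.Curve ℂ).HasTraversals j y η R} ≤ ENNReal.ofReal ε) → Summit.CriticalPhenomena.SAWScalingLimit.Theses.SAWLaplacianWalk.EventualTight := by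
  intro hE hB D a b hab
  obtain ⟨δ₀, hδ₀, hT⟩ :=
    Summit.CriticalPhenomena.SAWScalingLimit.Theorems.EventualTight_of_subs hE hB D a b hab
  exact isTightAlongMesh_of_isTightMeasureSet_image
    (Eventually.of_forall fun δ => (SAW.DomainSAW.measurable_of_top _).aemeasurable) hδ₀ hT

end Summit.CriticalPhenomena.SAWScalingLimit.Theorems.SAWLaplacianWalkSplit

end
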